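import Literature.IUT.HodgeArakelov.GMonoidFrobenioidsOverBase
import Literature.IUT.HodgeArakelov.TemperedThetaMonoidsCor37Proofs
import HarnessLib

/-!
# [IUTchII] Definition 3.8 (ii): the Gaussian Frobenioids `F_ξ(M^Θ_*)`, `F_{F_ξ}(†F_v)` as model Frobenioids of
# `G`-monoids over `𝓑(G)⁰`, and Corollary 3.7 (i) «⥲» at the Frobenioid level

S. Mochizuki, *Inter-universal Teichmüller theory II*, §3, kurims manuscript (Dec. 2020; render
IUTchII-kurims-url-5036b4059555): Definition 3.8 (ii) p. 113 l. 58 – p. 114 l. 28 «Each of the monoids equipped with a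
topological group action … `G_v(M^Θ_*▶)_⟨F_l^⋇⟩ ↷ Ψ_ξ(M^Θ_*)`; `G_v(M^Θ_*)_⟨F_l^⋇⟩ ↷ Ψ_{F_ξ}(†F_v)` [cf. … Corollary 3.5, (ii);
Corollary 3.6, (ii)] gives rise to a `p_v`-adic Frobenioid of monoid type `ℤ` [cf. [FrdII], Example 1.1, (ii)] …
`F_ξ(M^Θ_*)`; `F_{F_ξ}(†F_v)` … `F_gau(M^Θ_*) := {F_ξ(M^Θ_*)}_ξ`; `F_{F_gau}(†F_v) := {F_{F_ξ}(†F_v)}_ξ` … the isomorphisms of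
monoids in the bottom line of the third display of Corollary 3.6, (ii), may be interpreted as isomorphisms of split
Frobenioids `F_{†F^Θ_v,α} ⥲ F^ι_env(M^Θ_*) ⥲ F_ξ(M^Θ_*) ⥲ F_{F_ξ}(†F_v)`» [cite: Mochizuki2012, Def 3.8 (ii) p.113];
Corollary 3.5 (ii) p. 95 l. 11–14 «each `Ψ_ξ(M^Θ_*)` is equipped with a natural action by `G_v(M^Θ_*▶)_⟨F_l^⋇⟩`» — the
diagonal of (i) p. 94 l. 27–31 «the diagonal embedding, determined by suitable symmetrizing isomorphisms, inside the
direct product of copies labeled by `|t| ∈ F_l^⋇`», acting factor by factor, p. 95 l. 48–58 «the compatibility of the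
action of `G_v(M^Θ_*▶)_{|t|}` on the factor labeled `|t|` of the direct product … with the inclusions
`G_v(M^Θ_*) ↪ Π_{v▶}(M^Θ_*▶)` determined by the various choices of the `D^δ_{t,μ_-}` that gave rise to the value-profile
`ξ`»; Corollary 3.6 (iii) p. 100 «`Ψ_{F_ξ}(†F_v) = (Ψ^×_{†C_v})_⟨F_l^⋇⟩ · Im(ξ)^ℕ` — where `Im(ξ)` denotes the image of `ξ`
via the isomorphisms discussed in (ii)»; Corollary 3.7 (i) p. 111 l. 21 – p. 112 l. 6 «Each isomorphism of projective
systems of mono-theta environments `M^Θ_*(Π_v) ⥲ M^Θ_*(†F_v)` induces compatible [in the evident sense] collections of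
isomorphisms … `{G_v(M^Θ_*▶(†F_v))_{|t|}} ⥲ {G_v(M^Θ_*(†F_v))_{|t|}}` ↷↷ `Ψ_ξ(M^Θ_*(Π_v)) ⥲ Ψ_ξ(M^Θ_*(†F_v)) ⥲ Ψ_{F_ξ}(†F_v)`»
[cite: Mochizuki2012, Cor 3.7 (i) p.111].  D-0012 claim key, status disputed — nothing of the series is asserted.
[FrdI] Thm. 5.2 (i) p. 100, Cor. 5.4 p. 104 [cite: MochizukiFrdI2008, Cor. 5.4 p.104].

abc-iut cell, layer L6, MERGE-MAP register row **R-Def38-a**, item «GAUSSIAN-FRD» (plan/L6/MERGE-MAP.md §8S; L6-lead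
§F v1.19ca (2) W3), seat abc-iut-L6-t7 gen 6 (the register's writer).  CLASS (b) CONSTRUCTION over FROZEN vocabulary
consumed BY NAME, nothing re-declared: abc-iut-w4-d019's `CoveringMonoid.invariants / invariantsFunctor / divisorFunctor
/ ratFnFunctor / divB / frobenioid / ofStable` (p455796 — there the ambient of `ofStable` is a commutative GROUP),
abc-iut-L6-t2's `unitDiagonal`, `gaussianMonoid ξ = Ψ^×_⟨F_l^⋇⟩·ξ^ℕ`, `inftyGaussianMonoid`, `gaussianMonoid2l`, `piIso`,
`frobenioidGaussianMonoid`, `frobenioidGaussianMonoid_eq` (p404298), abc-iut-w4-d019's `map_piIso_gaussianMonoid /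
…infty… / …2l`, `exists_gaussianMonoidIso`, `piIso_diagonalAction_compat` (Cor 3.7 (i)) and `mem_of_map_piIso_eq`
(Cor 3.6 (ii)), abc-iut-L6-t7's `frobenioidMapOfPairIso (σ : G ≃ₜ* G') ψ hψ` + `_isEquivalence` (p468022, FROZEN
67315581ad3d2ea3).

WHAT IS CONSTRUCTED / PROVED.
* §1 `CoveringMonoid.restrictActMonoid / ofStableMonoid` — the MONOID-ambient twin of w4-d019's `ofStable`: a
  `ρ`-stable submonoid `S ⊆ N` of a commutative MONOID with `G`-action `ρ` is a `G`-monoid (`Ψ_ξ ⊆ ∏_{|t|} Ψ_cns,|t|` lives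
  in a product of copies of the MONOID `O^▷`); `mem_invariants_ofStableMonoid_iff`.
* §2 `diagonalAct T β : G →* MulAut (T → M)` — the DIAGONAL action `(x_t)_t ↦ (g·x_t)_t` of print's `G_v(−)_⟨F_l^⋇⟩` on
  `∏_{|t| ∈ F_l^⋇} Ψ_cns,|t|` (the tree's `piIso T (β g)`, now a homomorphism; `diagonalAct_apply` is `rfl`), and the
  STABILITY of `Ψ_ξ` under it GIVEN a value-profile fixed label by label, `hξ : ∀ g t, β g (ξ t) = ξ t`
  (`map_piIso_gaussianMonoid_of_fixed`, `gaussianMonoid_diagonalStable_of_fixed`) — print-side reason: `ξ_t ∈ θ^{|t|}_env`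
  is the restriction of the class `θ` to the decomposition group `D^δ_{t,μ_-} = G_v(−)_{|t|}`, which acts trivially on its
  own `H¹` (abc-iut-w5-d100's `hfix`, `…SyncMonoidProofs`); at the genuine data the `ξ_t` are `μ_{2l}`-translates of
  `q̲_v^{j²} ∈ K_v` ([IUTchI] Ex. 3.2 (iv) «`q_v` admits a `2l`-th root in `O^▹_{K_v}`», render IUTchI-kurims-url-690e7b3c6199
  p. 71 l. 26–33) — this CLOSES the gen-5 SHAPES memo's worry about label-dependent roots of unity `ζ_t` (renders quoted:
  IUTchII-kurims p. 94 l. 27–31, p. 95 l. 2–14 / 48–66, p. 111 l. 21 – p. 112 l. 6, p. 113 l. 58 – p. 114 l. 28; reading of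
  record, L6-lead §F v1.19cg).  The `G`-monoid below takes the bare STABILITY `hS` as input (print:
  «natural action»), so every producer of record (w4-d004's `mrange_pi_diagonalStable…` with `mrange_pi_eq_gaussianMonoid`,
  w5-d100, w4-d019's Cor 3.6 `…_diagonalStable_of_equivariant`) feeds it BY NAME.
* §3 **`gaussianCovering β ξ hS : CoveringMonoid G`** = `G_⟨F_l^⋇⟩ ↷ Ψ_ξ`; **`Fgau β ξ hS`** = `F_ξ(M^Θ_*)`, the [FrdI] Thm 5.2
  model Frobenioid over `𝓑(G)⁰ = CosetCat G` (inhabited: `nonempty_Fgau`); `inftyGaussianCovering`; **`FFgau γ e ξ hS`** =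
  `F_{F_ξ}(†F_v)`, the same construction at the transported value-profile `Im(ξ) = e⁻¹ ∘ ξ` along the labelled Kummer
  copies `e : (Ψ_{†C_v})_t ⥲ Ψ_cns,t` — print's Cor 3.6 (iii) presentation `Ψ_{F_ξ}(†F_v) = (Ψ^×_{†C_v})_⟨F_l^⋇⟩·Im(ξ)^ℕ`,
  which IS w4-d004's `frobenioidGaussianMonoid e ξ` (Cor 3.6 (ii)) by `frobenioidGaussianMonoid_eq` — the
  identity-on-elements isomorphism `frobenioidGaussianMonoidCongr`.
* §4 **Cor 3.7 (i) / Def 3.8 (ii) at the Frobenioid level**: the middle isomorphism of monoids as DATA,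
  `gaussianMonoidIso m ξ : Ψ_ξ ⥲ Ψ_{m∘ξ}` pinned to `piIso T m` (the term of w4-d019's `exists_gaussianMonoidIso`), its
  equivariance for the diagonal actions through `σ : G ⥲ G'` (`gaussianMonoidIso_act`), and
  **`fgauMapOfPairIso σ m hm ξ hS hS' : Fgau β ξ hS ⥤ Fgau β' (m∘ξ) hS'`**
  over `𝓑(G)⁰ ≌ 𝓑(G')⁰` on the nose (`_comp_baseFunctor`), an EQUIVALENCE (`_isEquivalence`) — «isomorphisms of split
  Frobenioids `F_ξ(M^Θ_*(Π_v)) ⥲ F_ξ(M^Θ_*(†F_v))`»; with `m := e⁻¹`, `F_ξ(M^Θ_*) ⥲ F_{F_ξ}(†F_v)` (`fgauToFFgau`,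
  `_isEquivalence`).  The `∞`/`2l` stability lemmas, the transported stability and the [FrdI] Thm 5.2 hypotheses are the
  proof-only companion's (`GMonoidFrobenioidsGaussianProofs`).
HONEST LIMITS: (1) the identifications of the acting groups (`G_v(M^Θ_*▶(†F_v)) ≅ G_v(M^Θ_*(†F_v))`, the symmetrizing
isomorphisms behind `⟨F_l^⋇⟩`) and the comparison `m` of constant monoids induced by an isomorphism of mono-theta
environments (Prop 3.4 (ii)) are INPUTS; (2) [FrdI] Thm 5.2's `ModelFrobenioid.Hypotheses` and the «divisor monoid `≅ ℕ`
at every object» clause for `F_ξ` are the proof-only companion's, not done here; (3) the «splittings» of these split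
Frobenioids are the monoid-level splittings up to torsion of Cor 3.5 (iii) / 3.6 (iii) (abc-iut-L6-t2, w4-d019), not
re-typed at the Frobenioid level; (4) the `∞`-monoids get a `G`-monoid but no Frobenioid (Def 3.8 attaches Frobenioids to
`Ψ_ξ`, `Ψ_{F_ξ}` only).  No `instance`, no `Prop`-valued definition, no notation, no sorry; typed ≠ proved; nothing here
bears on [IUTchIII] Cor. 3.12; nothing asserts abc proved or refuted.
-/


noncomputable section

namespace Literature.IUT.HodgeArakelov

open CategoryTheory Opposite Function
open Literature.AlgebraicGeometry.Frobenioids Literature.AnabelianGeometry.SemiGraphs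

universe u v w

/-! ### 1. `G`-monoids cut out of an ambient commutative MONOID with `G`-action -/

namespace CoveringMonoid

section StableMonoid

variable {G : Type u} [Group G] {N : Type v} [CommMonoid N] (ρ : G →* MulAut N) (S : Submonoid N)
  (hS : ∀ (g : G) (x : N), x ∈ S → ρ g x ∈ S)

/-- The action `ρ : G → Aut(N)` of `G` on a commutative MONOID `N` restricted to a `ρ`-stable submonoid `S ⊆ N` (the
monoid-ambient twin of abc-iut-w4-d019's `restrictAct`, whose ambient is a group): how print's
`G_v(M^Θ_*▶)_⟨F_l^⋇⟩ ↷ Ψ_ξ(M^Θ_*) ⊆ ∏_{|t|} Ψ_cns(M^Θ_*)_{|t|}` is an action ON `Ψ_ξ`. [cite: Mochizuki2012, Def 3.8 (ii) p.113] -/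
def restrictActMonoid : G →* MulAut S where
  toFun g :=
    { toFun := fun x => ⟨ρ g x.1, hS g x.1 x.2⟩
      invFun := fun x => ⟨ρ g⁻¹ x.1, hS g⁻¹ x.1 x.2⟩
      left_inv := fun x => Subtype.ext (by
        change ρ g⁻¹ (ρ g x.1) = x.1
        rw [← MulAut.mul_apply, ← map_mul, inv_mul_cancel, map_one, MulAut.one_apply])
      right_inv := fun x => Subtype.ext (by
        change ρ g (ρ g⁻¹ x.1) = x.1
        rw [← MulAut.mul_apply, ← map_mul, mul_inv_cancel, map_one, MulAut.one_apply])
      map_mul' := fun x y => Subtype.ext (map_mul (ρ g) x.1 y.1) }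
  map_one' := by
    ext x
    change ρ 1 (x : N) = (x : N)
    rw [map_one, MulAut.one_apply]
  map_mul' g g' := by
    ext x
    change ρ (g * g') (x : N) = ρ g (ρ g' (x : N))
    rw [map_mul, MulAut.mul_apply]

/-- `restrictActMonoid` is `ρ` on underlying elements. [cite: Mochizuki2012, Def 3.8 (ii) p.113] -/
@[simp] theorem coe_restrictActMonoid_apply (g : G) (x : S) :
    ((restrictActMonoid ρ S hS g x : S) : N) = ρ g (x : N) := rfl

/-- **A `ρ`-stable submonoid `S` of a commutative monoid `N` with `G`-action `ρ` is a `G`-monoid** (abc-iut-L6-t2's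
`KummerStructures.CoveringMonoid`: `O := S`, `act := ρ|_S`) — the monoid-ambient twin of w4-d019's `ofStable`; this is how
the Gaussian monoids `Ψ_ξ`, `Ψ_{F_ξ}` of Cor 3.5 (ii) / 3.6 (ii), which live in products of copies of the MONOID `O^▷`,
carry the actions Def 3.8 (ii) attaches Frobenioids to. [cite: Mochizuki2012, Def 3.8 (ii) p.113] -/
abbrev ofStableMonoid : CoveringMonoid.{u, v} G :=
  { O := S, act := restrictActMonoid ρ S hS }

/-- Invariants of `ofStableMonoid ρ S hS` under `U ≤ G`: the elements of `S` fixed by `ρ(U)` — the monoid `Ψ^U` the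
Frobenioid attaches to the connected object `G/U` of `𝓑(G)⁰`. [cite: Mochizuki2012, Def 3.8 (ii) p.113] -/
theorem mem_invariants_ofStableMonoid_iff (U : Subgroup G) (x : S) :
    x ∈ (ofStableMonoid ρ S hS).invariants U ↔ ∀ u ∈ U, ρ u (x : N) = (x : N) := by
  rw [mem_invariants_iff]
  refine forall₂_congr fun u _ => ?_
  exact ⟨fun h => congrArg Subtype.val h, fun h => Subtype.ext h⟩

end StableMonoid

end CoveringMonoid

namespace BadPrimeGaussianMonoids

open TemperedThetaMonoids

/-! ### 2. The diagonal action `G_⟨F_l^⋇⟩ ↷ ∏_{|t| ∈ F_l^⋇} Ψ_{|t|}` and the stability of the Gaussian monoids -/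

section Diagonal

variable (T : Type w) {M : Type v} [CommMonoid M] {G : Type u} [Group G] (β : G →* MulAut M)

/-- **The diagonal action** of `G` on the product `∏_{|t| ∈ F_l^⋇} Ψ_{|t|} = (T → M)` of labelled copies of a monoid `Ψ`
with `G`-action `β`: `g ↦ ((x_t)_t ↦ (g·x_t)_t)`, i.e. `g ↦ piIso T (β g)` — the action of print's diagonal
`G_v(M^Θ_*▶)_⟨F_l^⋇⟩ ⊆ ∏_{|t|} G_v(M^Θ_*▶)_{|t|}` («the diagonal embedding, determined by suitable symmetrizing isomorphisms,
inside the direct product of copies labeled by `|t| ∈ F_l^⋇`», Cor 3.5 (i) p. 94, acting factor by factor, (ii) p. 95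
l. 48–51), as a homomorphism `G → Aut(∏ Ψ_{|t|})`. [cite: Mochizuki2012, Cor 3.5 (ii) p.95] -/
def diagonalAct : G →* MulAut (T → M) where
  toFun g := piIso T (β g)
  map_one' := by
    ext x t
    change (β 1) (x t) = x t
    rw [map_one, MulAut.one_apply]
  map_mul' g h := by
    ext x t
    change (β (g * h)) (x t) = (β g) ((β h) (x t))
    rw [map_mul, MulAut.mul_apply]

/-- `diagonalAct T β g` IS the labelwise transport `piIso T (β g)` of the tree (`rfl`). [cite: Mochizuki2012, Cor 3.5 (ii) p.95] -/
@[simp] theorem diagonalAct_apply (g : G) (x : T → M) : diagonalAct T β g x = piIso T (β g) x := rfl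

/-- … i.e. `(g·x)_t = g·x_t` factor by factor. [cite: Mochizuki2012, Cor 3.5 (ii) p.95] -/
theorem diagonalAct_apply_apply (g : G) (x : T → M) (t : T) : diagonalAct T β g x t = β g (x t) := rfl

variable {T}

/-- A value-profile fixed label by label is fixed by the diagonal action. [cite: Mochizuki2012, Cor 3.5 (ii) p.95] -/
theorem piIso_eq_self_of_fixed (φ : M ≃* M) {ξ : T → M} (hξ : ∀ t, φ (ξ t) = ξ t) : piIso T φ ξ = ξ :=
  funext hξ

/-- **Stability of `Ψ_ξ = Ψ^×_⟨F_l^⋇⟩·ξ^ℕ`** under the labelwise transport by an automorphism `φ` of `Ψ` fixing the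
value-profile label by label: `φ(Ψ_ξ) = Ψ_{φ∘ξ} = Ψ_ξ` (w4-d019's `map_piIso_gaussianMonoid` BY NAME).
[cite: Mochizuki2012, Cor 3.5 (ii) p.95] -/
theorem map_piIso_gaussianMonoid_of_fixed (φ : M ≃* M) {ξ : T → M} (hξ : ∀ t, φ (ξ t) = ξ t) :
    (gaussianMonoid ξ).map (piIso T φ).toMonoidHom = gaussianMonoid ξ := by
  rw [map_piIso_gaussianMonoid]
  exact congrArg gaussianMonoid (funext hξ)

/-- **Cor 3.5 (ii) p. 95 «each `Ψ_ξ(M^Θ_*)` is equipped with a natural action by `G_v(M^Θ_*▶)_⟨F_l^⋇⟩`»**, pointwise form: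
`Ψ_ξ` is stable under the diagonal action as soon as the value-profile is fixed label by label — `ξ_t` being the
restriction of `θ` to the decomposition group `G_v(−)_{|t|} = D^δ_{t,μ_-}`, which acts trivially on its own `H¹`
(w5-d100's `hfix`), resp. a `μ_{2l}`-translate of `q̲_v^{j²} ∈ K_v` at the genuine data ([IUTchI] Ex. 3.2 (iv)).
[cite: Mochizuki2012, Cor 3.5 (ii) p.95] -/
theorem gaussianMonoid_diagonalStable_of_fixed {ξ : T → M} (hξ : ∀ (g : G) (t : T), β g (ξ t) = ξ t) :
    ∀ (g : G) (y : T → M), y ∈ gaussianMonoid ξ → piIso T (β g) y ∈ gaussianMonoid ξ :=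
  fun g _ hy => mem_of_map_piIso_eq (map_piIso_gaussianMonoid_of_fixed (β g) (hξ g)) hy

end Diagonal

/-! ### 3. The Gaussian `G`-monoids and the Frobenioids `F_ξ(M^Θ_*)`, `F_{F_ξ}(†F_v)` -/

section Gaussian

variable {T : Type w} {M : Type v} [CommMonoid M] {G : Type u} [Group G] (β : G →* MulAut M)

/-- **`G_v(M^Θ_*▶)_⟨F_l^⋇⟩ ↷ Ψ_ξ(M^Θ_*)` as a `G`-monoid**: the Gaussian monoid `Ψ_ξ = Ψ^×_⟨F_l^⋇⟩·ξ^ℕ ⊆ ∏_{|t|} Ψ_{|t|}`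
(w4-d004, BY NAME) with the diagonal action, GIVEN its stability `hS` under that action (print: «natural action»,
Cor 3.5 (ii) p. 95; producers: `gaussianMonoid_diagonalStable_of_fixed`, w4-d004's `mrange_pi_diagonalStable…` with
`mrange_pi_eq_gaussianMonoid`, w5-d100's `…SyncMonoidProofs`). [cite: Mochizuki2012, Def 3.8 (ii) p.113] -/
abbrev gaussianCovering (ξ : T → M)
    (hS : ∀ (g : G) (y : T → M), y ∈ gaussianMonoid ξ → piIso T (β g) y ∈ gaussianMonoid ξ) :
    CoveringMonoid.{u, max w v} G :=
  CoveringMonoid.ofStableMonoid (diagonalAct T β) (gaussianMonoid ξ) hS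

/-- `G_⟨F_l^⋇⟩ ↷ ∞Ψ_ξ(M^Θ_*)` as a `G`-monoid (same construction at `∞Ψ_ξ = Ψ^×_⟨F_l^⋇⟩·ξ^{ℚ≥0}`; Def 3.8 attaches no
Frobenioid to it). [cite: Mochizuki2012, Cor 3.5 (ii) p.95] -/
abbrev inftyGaussianCovering (ξ : T → M)
    (hS : ∀ (g : G) (y : T → M), y ∈ inftyGaussianMonoid ξ → piIso T (β g) y ∈ inftyGaussianMonoid ξ) :
    CoveringMonoid.{u, max w v} G :=
  CoveringMonoid.ofStableMonoid (diagonalAct T β) (inftyGaussianMonoid ξ) hS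

/-- The action of the Gaussian `G`-monoid on underlying families is the diagonal action.
[cite: Mochizuki2012, Cor 3.5 (ii) p.95] -/
theorem coe_gaussianCovering_act (ξ : T → M)
    (hS : ∀ (g : G) (y : T → M), y ∈ gaussianMonoid ξ → piIso T (β g) y ∈ gaussianMonoid ξ) (g : G)
    (x : gaussianMonoid ξ) : (((gaussianCovering β ξ hS).act g x : gaussianMonoid ξ) : T → M) = piIso T (β g) x := rfl

/-- Invariants of the Gaussian `G`-monoid under `U ≤ G`: the families of `Ψ_ξ` fixed label by label by `β(U)` — the
monoid `F_ξ(M^Θ_*)` attaches to the connected object `G/U`. [cite: Mochizuki2012, Def 3.8 (ii) p.113] -/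
theorem mem_invariants_gaussianCovering_iff (ξ : T → M)
    (hS : ∀ (g : G) (y : T → M), y ∈ gaussianMonoid ξ → piIso T (β g) y ∈ gaussianMonoid ξ) (U : Subgroup G)
    (x : gaussianMonoid ξ) :
    x ∈ (gaussianCovering β ξ hS).invariants U ↔ ∀ u ∈ U, ∀ t, β u ((x : T → M) t) = (x : T → M) t := by
  rw [CoveringMonoid.mem_invariants_ofStableMonoid_iff]
  refine forall₂_congr fun u _ => ?_
  exact ⟨fun h t => congrFun h t, fun h => funext h⟩

variable [TopologicalSpace G]

/-- **`F_ξ(M^Θ_*)`** — the Frobenioid Def 3.8 (ii) attaches to `G_v(M^Θ_*▶)_⟨F_l^⋇⟩ ↷ Ψ_ξ(M^Θ_*)` («gives rise to a `p_v`-adic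
Frobenioid of monoid type `ℤ`»): abc-iut-L1-t2's [FrdI] Thm 5.2 model Frobenioid of w4-d019's data
`(Φ, B, Div_B) = (Ψ_ξ^{(-)}/units, (Ψ_ξ^{(-)})^gp, class map)` over `𝓑(G)⁰ = CosetCat G`; `F_gau(M^Θ_*) = {F_ξ(M^Θ_*)}_ξ`
is this family in `ξ`. [cite: Mochizuki2012, Def 3.8 (ii) p.113] -/
abbrev Fgau (ξ : T → M)
    (hS : ∀ (g : G) (y : T → M), y ∈ gaussianMonoid ξ → piIso T (β g) y ∈ gaussianMonoid ξ) : Type (max u w v) :=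
  (gaussianCovering β ξ hS).frobenioid

/-- `F_ξ(M^Θ_*)` is inhabited (by the Frobenius-trivial object over `G/G`). [cite: Mochizuki2012, Def 3.8 (ii) p.113] -/
theorem nonempty_Fgau (ξ : T → M)
    (hS : ∀ (g : G) (y : T → M), y ∈ gaussianMonoid ξ → piIso T (β g) y ∈ gaussianMonoid ξ) :
    Nonempty (Fgau β ξ hS) :=
  (gaussianCovering β ξ hS).nonempty_frobenioid

variable {N : Type v} [CommMonoid N] (γ : G →* MulAut N) (e : N ≃* M)

omit [TopologicalSpace G] in
/-- **Cor 3.6 (iii) p. 100 «`Ψ_{F_ξ}(†F_v) = (Ψ^×_{†C_v})_⟨F_l^⋇⟩ · Im(ξ)^ℕ`»** as an isomorphism of monoids: w4-d004's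
`Ψ_{F_ξ}(†F_v) := (piIso e)⁻¹(Ψ_ξ)` (`frobenioidGaussianMonoid e ξ`, Cor 3.6 (ii) «the submonoid determined, via the
isomorphisms `(Ψ_{†C_v})_{|t|} ⥲ Ψ_cns(M^Θ_*)_{|t|}`, by `Ψ_ξ`») IS the Gaussian monoid of the transported value-profile
`Im(ξ) = e⁻¹ ∘ ξ` — the identity on elements (`frobenioidGaussianMonoid_eq` BY NAME). [cite: Mochizuki2012, Cor 3.6 (iii) p.100] -/
def frobenioidGaussianMonoidCongr (ξ : T → M) :
    frobenioidGaussianMonoid e ξ ≃* gaussianMonoid (fun t => e.symm (ξ t)) :=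
  MulEquiv.submonoidCongr (frobenioidGaussianMonoid_eq e ξ)

omit [TopologicalSpace G] in
/-- `frobenioidGaussianMonoidCongr` is the identity on underlying families. [cite: Mochizuki2012, Cor 3.6 (iii) p.100] -/
@[simp] theorem coe_frobenioidGaussianMonoidCongr (ξ : T → M) (x : frobenioidGaussianMonoid e ξ) :
    ((frobenioidGaussianMonoidCongr e ξ x : gaussianMonoid (fun t => e.symm (ξ t))) : T → N) = x := rfl

/-- **`F_{F_ξ}(†F_v)`** — the Frobenioid Def 3.8 (ii) attaches to `G_v(M^Θ_*)_⟨F_l^⋇⟩ ↷ Ψ_{F_ξ}(†F_v) ⊆ ∏_{|t|} (Ψ_{†C_v})_{|t|}`: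
by Cor 3.6 (iii) «`Ψ_{F_ξ}(†F_v) = (Ψ^×_{†C_v})_⟨F_l^⋇⟩ · Im(ξ)^ℕ`» it is `F_{Im(ξ)}` for the monoid `Ψ_{†C_v}` with its action
`γ` and the transported value-profile `Im(ξ) = e⁻¹ ∘ ξ` (`e` = the labelled Kummer copies of Cor 3.6 (i));
`F_{F_gau}(†F_v) = {F_{F_ξ}(†F_v)}_ξ`. [cite: Mochizuki2012, Def 3.8 (ii) p.113] -/
abbrev FFgau (ξ : T → M)
    (hS : ∀ (g : G) (y : T → N), y ∈ gaussianMonoid (fun t => e.symm (ξ t)) →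
      piIso T (γ g) y ∈ gaussianMonoid (fun t => e.symm (ξ t))) : Type (max u w v) :=
  Fgau γ (fun t => e.symm (ξ t)) hS

end Gaussian

/-! ### 4. Cor 3.7 (i) / Def 3.8 (ii): `F_ξ(M^Θ_*(Π_v)) ⥲ F_{m∘ξ}(M^Θ_*(†F_v)) ⥲ F_{F_ξ}(†F_v)` as equivalences of
model Frobenioids induced by isomorphisms of PAIRS -/

section Cor37

variable {T : Type w} {M : Type v} [CommMonoid M] {M' : Type v} [CommMonoid M']
  {G : Type u} [Group G] {G' : Type u} [Group G'] (β : G →* MulAut M) (β' : G' →* MulAut M')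

/-- **Cor 3.7 (i), the middle isomorphism `Ψ_ξ(M^Θ_*(Π_v)) ⥲ Ψ_ξ(M^Θ_*(†F_v))` as DATA**: the labelwise transport
`piIso T m` restricted to `Ψ_ξ ⥲ Ψ_{m∘ξ}` (the very term behind w4-d019's `exists_gaussianMonoidIso`, over its
`map_piIso_gaussianMonoid`). [cite: Mochizuki2012, Cor 3.7 (i) p.111] -/
def gaussianMonoidIso (m : M ≃* M') (ξ : T → M) : gaussianMonoid ξ ≃* gaussianMonoid (fun t => m (ξ t)) :=
  ((piIso T m).submonoidMap (gaussianMonoid ξ)).trans (MulEquiv.submonoidCongr (map_piIso_gaussianMonoid m ξ))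

/-- `gaussianMonoidIso m ξ` is `piIso T m` on underlying families. [cite: Mochizuki2012, Cor 3.7 (i) p.111] -/
@[simp] theorem coe_gaussianMonoidIso (m : M ≃* M') (ξ : T → M) (x : gaussianMonoid ξ) :
    ((gaussianMonoidIso m ξ x : gaussianMonoid (fun t => m (ξ t))) : T → M') = piIso T m x := rfl

section Pair

variable {σ : G → G'} (m : M ≃* M') (hm : ∀ (g : G) (y : M), m (β g y) = β' (σ g) (m y)) {ξ : T → M}
  (hS : ∀ (g : G) (y : T → M), y ∈ gaussianMonoid ξ → piIso T (β g) y ∈ gaussianMonoid ξ)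

include hm in
/-- **Cor 3.7 (i) «↷↷ … compatible»**: the middle isomorphism is EQUIVARIANT for the diagonal actions through `σ` — an
isomorphism of the PAIRS `(G ↷ Ψ_ξ) ⥲ (G' ↷ Ψ_{m∘ξ})` (w4-d019's `piIso_diagonalAction_compat` BY NAME).
[cite: Mochizuki2012, Cor 3.7 (i) p.111] -/
theorem gaussianMonoidIso_act
    (hS' : ∀ (g' : G') (y' : T → M'), y' ∈ gaussianMonoid (fun t => m (ξ t)) →
      piIso T (β' g') y' ∈ gaussianMonoid (fun t => m (ξ t))) (g : G) (x : gaussianMonoid ξ) :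
    gaussianMonoidIso m ξ ((gaussianCovering β ξ hS).act g x) =
      (gaussianCovering β' (fun t => m (ξ t)) hS').act (σ g) (gaussianMonoidIso m ξ x) :=
  Subtype.ext (by
    change piIso T m (piIso T (β g) (x : T → M)) = piIso T (β' (σ g)) (piIso T m (x : T → M))
    exact piIso_diagonalAction_compat σ (fun g => β g) (fun g' => β' g') m hm g (x : T → M))

end Pair

section Frobenioid

variable [TopologicalSpace G] [TopologicalSpace G'] (σ : G ≃ₜ* G') (m : M ≃* M')
  (hm : ∀ (g : G) (y : M), m (β g y) = β' (σ g) (m y)) (ξ : T → M)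
  (hS : ∀ (g : G) (y : T → M), y ∈ gaussianMonoid ξ → piIso T (β g) y ∈ gaussianMonoid ξ)
  (hS' : ∀ (g' : G') (y' : T → M'), y' ∈ gaussianMonoid (fun t => m (ξ t)) →
    piIso T (β' g') y' ∈ gaussianMonoid (fun t => m (ξ t)))

include hm

/-- **Def 3.8 (ii) / Cor 3.7 (i) at the Frobenioid level — «isomorphisms of split Frobenioids
`F_ξ(M^Θ_*(Π_v)) ⥲ F_ξ(M^Θ_*(†F_v))`»**: the functor of model Frobenioids `F_ξ ⥤ F_{m∘ξ}` induced by the isomorphism of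
pairs `(σ, gaussianMonoidIso m ξ) : (G ↷ Ψ_ξ) ⥲ (G' ↷ Ψ_{m∘ξ})` over the equivalence of bases `𝓑(G)⁰ ≌ 𝓑(G')⁰`
(abc-iut-L6-t7's `frobenioidMapOfPairIso`, p468022, BY NAME): `σ` = the identification of the labelled groups
`{G_v(Π_{v▶})_{|t|}} ⥲ {G_v(M^Θ_*▶(†F_v))_{|t|}}`, `m` = the comparison of constant monoids induced by the isomorphism of
mono-theta environments (Prop 3.4 (ii)) — both INPUTS. [cite: Mochizuki2012, Def 3.8 (ii) p.114] -/
def fgauMapOfPairIso : Fgau β ξ hS ⥤ Fgau β' (fun t => m (ξ t)) hS' :=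
  CoveringMonoid.frobenioidMapOfPairIso (M := gaussianCovering β ξ hS) (M' := gaussianCovering β' (fun t => m (ξ t)) hS')
    σ (gaussianMonoidIso m ξ) (gaussianMonoidIso_act β β' m hm hS hS')

/-- `fgauMapOfPairIso` lies over the equivalence of bases `pull σ⁻¹ : 𝓑(G)⁰ → 𝓑(G')⁰` ON THE NOSE.
[cite: Mochizuki2012, Cor 3.7 (i) p.111] -/
theorem fgauMapOfPairIso_comp_baseFunctor :
    fgauMapOfPairIso β β' σ m hm ξ hS hS' ⋙ ModelFrobenioid.baseFunctor
        (gaussianCovering β' (fun t => m (ξ t)) hS').divisorFunctor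
        (gaussianCovering β' (fun t => m (ξ t)) hS').ratFnFunctor (gaussianCovering β' (fun t => m (ξ t)) hS').divB =
      ModelFrobenioid.baseFunctor (gaussianCovering β ξ hS).divisorFunctor (gaussianCovering β ξ hS).ratFnFunctor
          (gaussianCovering β ξ hS).divB ⋙
        CosetCat.pull σ.symm.toMonoidHom σ.symm.continuous σ.symm.surjective := rfl

/-- **`F_ξ(M^Θ_*(Π_v)) ⥲ F_{m∘ξ}(M^Θ_*(†F_v))` is an EQUIVALENCE of model Frobenioids** ([FrdI] Cor. 5.4 over the
equivalence of bases; p468022's `frobenioidMapOfPairIso_isEquivalence`). [cite: Mochizuki2012, Def 3.8 (ii) p.114] -/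
theorem fgauMapOfPairIso_isEquivalence : (fgauMapOfPairIso β β' σ m hm ξ hS hS').IsEquivalence :=
  CoveringMonoid.frobenioidMapOfPairIso_isEquivalence (M := gaussianCovering β ξ hS)
    (M' := gaussianCovering β' (fun t => m (ξ t)) hS') σ (gaussianMonoidIso m ξ) (gaussianMonoidIso_act β β' m hm hS hS')

end Frobenioid

section Kummer

variable [TopologicalSpace G] [TopologicalSpace G'] {N : Type v} [CommMonoid N] (γ : G' →* MulAut N) (e : N ≃* M)
  (σ : G ≃ₜ* G') (he : ∀ (g : G) (y : M), e.symm (β g y) = γ (σ g) (e.symm y)) (ξ : T → M)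
  (hS : ∀ (g : G) (y : T → M), y ∈ gaussianMonoid ξ → piIso T (β g) y ∈ gaussianMonoid ξ)
  (hS' : ∀ (g' : G') (y' : T → N), y' ∈ gaussianMonoid (fun t => e.symm (ξ t)) →
    piIso T (γ g') y' ∈ gaussianMonoid (fun t => e.symm (ξ t)))

include he in
/-- **Def 3.8 (ii) «`F_ξ(M^Θ_*) ⥲ F_{F_ξ}(†F_v)`»** (Cor 3.7 (i), lower right-hand portion «obtained by applying the
right-hand portion of the third display of Corollary 3.6, (ii)»): the case `m := e⁻¹` of `fgauMapOfPairIso` — the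
labelled Kummer copies `e : (Ψ_{†C_v})_t ⥲ Ψ_cns,t` (Cor 3.6 (i)), equivariant through the identification
`σ : G_v(M^Θ_*▶)_⟨F_l^⋇⟩ ⥲ G_v(M^Θ_*)_⟨F_l^⋇⟩`, carry `F_ξ(M^Θ_*)` to `F_{F_ξ}(†F_v) = F_{Im(ξ)}`.
[cite: Mochizuki2012, Def 3.8 (ii) p.114] -/
abbrev fgauToFFgau : Fgau β ξ hS ⥤ FFgau γ e ξ hS' := fgauMapOfPairIso β γ σ e.symm he ξ hS hS'

include he in
/-- `F_ξ(M^Θ_*) ⥲ F_{F_ξ}(†F_v)` is an equivalence of model Frobenioids. [cite: Mochizuki2012, Def 3.8 (ii) p.114] -/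
theorem fgauToFFgau_isEquivalence : (fgauToFFgau β γ e σ he ξ hS hS').IsEquivalence :=
  fgauMapOfPairIso_isEquivalence β γ σ e.symm he ξ hS hS'

end Kummer

end Cor37

end BadPrimeGaussianMonoids

end Literature.IUT.HodgeArakelov

end
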